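import Literature.IUT.HodgeArakelov.EtaleThetaDataOfSettingInversion
import Literature.AnabelianGeometry.EtaleTheta.SettingModelTateDoubleUnderline
import Literature.AnabelianGeometry.EtaleTheta.SettingModelTateEllCoordinates
import HarnessLib

/-!
# The extension property `hextΔ` at the stage-2 Tate model: the EXACT REDUCTION to an automorphism-extension problem
# `dUU l ≤ Γ` with twisted equivariance (proof-only; K-L6 row «HEXT-DECIDE@modelχq», the booked reduction (1) in kernel)

S. Mochizuki, *The étale theta function and its Frobenioid-theoretic manifestations* [EtTh], Publ. RIMS **45** (2009)
(refereed), §2, Prop. 2.4 p. 38 (every automorphism of `Π^tp_{X̲̲}` arises from one of `Π^tp_X`)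
[cite: MochizukiEtTh2009, Prop 2.4 p.38]; §1 p. 12 (`Π^tp_X`, `Δ^tp_X`); Def. 2.5 (i) p. 39 (`X̲̲`).
Cell `abc-iut`, seat abc-iut-w5-d169 (gen 11; K-L6 row «HEXT-DECIDE@modelχq», verdict of record 2026-08-27T04:04:31Z «UNDECIDED-AT-
MODEL … exact reduction booked», abc-iut-L6-lead §F v1.19du (B) / v1.19eb (E) GO).  PROOF-ONLY: NO definition, NO instance, NO new
named fact; companion of this lineage's (K1) `ThetaSettingHextFamiliesAtModelTate` (p496371).  v2 = v1 + §4 (append-only).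

THE BINDER (displayed by p490266 / p491246 / p492265 / p493130 / p490639), at an `X̲̲`-choice `C` over `modelχq p i j`
(`Π^tp_X = Γ ⋊_{actχq} G_{ℚ_p}` = `PiTpχq p i j`, `Γ = F̂₂ ×_Ẑ ℤ` = `Gfp`, `Δ^tp_X = inl Γ`) whose `Π^tp_{X̲̲} = C.Huu` is the
carrier of record `dUU l ⋊ G_{ℚ_p}` = `Huuχq p i j l hl` (recorded by the membership clauses `hinl`/`hinr`/`hleft`, each a theorem
at `Huuχq`: `inl_mem_Huuχq_iff`, `inr_mem_Huuχq`, `mem_Huuχq_iff`):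
  `hextΔ(γ) : ∃ Γ : Π^tp_X ≃ₜ* Π^tp_X, Γ|_{Π^tp_{X̲̲}} = γ ∧ Γ(Δ^tp_X) = Δ^tp_X`     (`γ : Π^tp_{X̲̲} ≃ₜ* Π^tp_{X̲̲}`).

WHAT THIS FILE PROVES — `hext_at_iff_exists_gfpAut` (§3) and its sharpening `hext_at_iff_exists_gfpAut'` (§4):
  `hextΔ(γ) ⟺ ∃ Φ : Γ ≃ₜ* Γ` (a bi-continuous automorphism of the GEOMETRIC group ALONE) with
    (i)  `inl (Φ d) = γ (inl d)` for `d ∈ dUU l`  — `Φ` extends the geometric part `γ|_{inl dUU l}`;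
    (ii) `inl (Φ (σ·g)) = γ(inr σ) · inl (Φ g) · γ(inr σ)⁻¹` in `Π^tp_X`  — TWISTED EQUIVARIANCE for the Tate action
         `σ·g = actχq σ g`, the twist READ OFF `γ` on the Galois section (`γ(inr σ) = (e_σ, ν σ)`); no `Aut(G_{ℚ_p})` enters;
  [(o) `Φ(dUU l) = dUU l`, carried in §1–§3, follows from (i) by finite index — §4 `map_dUU_eq_of_forall_mem`.]
  (⇒) §1 `exists_gfpAut_of_hext_at`: `Φ := Γ|_{inl Γ}` (by `Γ(Δ^tp_X) = Δ^tp_X`); (ii) as `inl (σ·g) = inr σ · inl g · inr σ⁻¹`.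
  (⇐) §2 `hext_at_of_gfpAut`: `Γ x := inl (Φ x.left) · γ (inr x.right)` — multiplicative by (ii), extends `γ` by (i), inverse
      `y ↦ inl (Φ⁻¹ y.left) · γ⁻¹ (inr y.right)`, and `Γ(Δ^tp_X) = Δ^tp_X`.
CONSEQUENCE (honest words): «`hextΔ` UNDECIDED-AT-MODEL» becomes ONE precise statement about `Aut_top(Γ)`.  The instruments of
record are one-directional SHADOWS of (i)(ii): abc-iut-L6-t13's level-kernel test (p496682 `map_ker_levelHom_eq`, p497023
`exists_continuousMonoidHom_restrict_of_map_deltaTemp_eq` / `not_hext_of_moves_levelKer`) and the class-2 hunts (R5-2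
abc-iut-w5-d233: «none at l = 3»; XTHETA-KER abc-iut-w5-d145).  Neither direction of `hextΔ` is claimed here.
HONEST LABEL. `modelχq` is a SEMI-SYNTHETIC model of the typed [EtTh] §1 interface (not the tempered `π₁` of a curve): statements
about OUR model and OUR typed binder only; nothing of [EtTh] / [IUTchII] (claim key `Mochizuki2012`, DISPUTED, D-0012) is asserted;
no side taken on [IUTchIII] Cor. 3.12; typed ≠ proved; nothing here bears on whether abc is proved or refuted.
bears_on: LADDER-ABC:A2.L-K (K-L6 «HEXT-DECIDE@modelχq») → LADDER-FRONTIER F-A2 (M·L6) → rung 0 `Summit.ABC`.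
-/

set_option autoImplicit false

noncomputable section

namespace Literature.AnabelianGeometry.EtaleTheta.SettingModel

open Literature.AnabelianGeometry.SemiGraphs
open Literature.IUT.HodgeArakelov Literature.IUT.HodgeArakelov.EtaleThetaDataOfSetting
open Function
open _root_.Topology

variable {p : ℕ} [Fact p.Prime] {i j : ℤ} {hj : Even j} {E : (ThetaSetting.modelχq p i j hj).EtaleThetaData} {l : ℕ}
  (C : E.DoubleUnderline l) {l' : ℕ+}
  (hinl : ∀ d ∈ dUU l', (SemidirectProduct.inl d : PiTpχq p i j) ∈ C.Huu)
  (hinr : ∀ σ : GQp p, (SemidirectProduct.inr σ : PiTpχq p i j) ∈ C.Huu)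
  (hleft : ∀ h ∈ C.Huu, (h : PiTpχq p i j).left ∈ dUU l')

/-! ## §1. (⇒) From an extension `Γ` to the automorphism `Φ := Γ|_{inl Γ}` of the geometric group -/

/-- An automorphism `Γ` of `Π^tp_X` with `Γ(Δ^tp_X) = Δ^tp_X` has `Γ (inl g) = inl ((Γ (inl g)).left)`.
[cite: MochizukiEtTh2009, §1 p.12] -/
theorem apply_inl_eq_inl_left_of_map_deltaTemp_eq (Γ : PiTpχq p i j ≃ₜ* PiTpχq p i j)
    (hΔ : (curveχq p i j).DeltaTemp.map Γ.toMulEquiv.toMonoidHom = (curveχq p i j).DeltaTemp) (g : Gfp) :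
    Γ (SemidirectProduct.inl g) = SemidirectProduct.inl (Γ (SemidirectProduct.inl g)).left := by
  have hmem : Γ (SemidirectProduct.inl g) ∈ (curveχq p i j).DeltaTemp := by
    rw [← hΔ]
    exact ⟨SemidirectProduct.inl g, inl_mem_deltaTempχq p i j g, rfl⟩
  exact eq_inl_of_right_eq_oneq p i j ((mem_deltaTempχq_iff p i j _).mp hmem)

include hinl hinr hleft in
/-- **(⇒) THE GEOMETRIC PART OF AN EXTENSION.** If `γ` extends to a `Δ^tp_X`-stabilising bi-continuous automorphism `Γ` of
`Π^tp_X` (the clause `hextΔ(γ)`), then `Φ := Γ|_{inl Γ}` is a bi-continuous automorphism of `Γ = Gfp` with (o) `Φ(dUU l) = dUU l`,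
(i) `inl (Φ d) = γ (inl d)` on `dUU l`, and (ii) the twisted equivariance `inl (Φ (σ·g)) = γ(inr σ) · inl (Φ g) · γ(inr σ)⁻¹`.
[cite: MochizukiEtTh2009, Prop 2.4 p.38] -/
theorem exists_gfpAut_of_hext_at (γ : ↥C.Huu ≃ₜ* ↥C.Huu)
    (hγ : ∃ Γ : PiTpχq p i j ≃ₜ* PiTpχq p i j,
      (∀ h : C.Huu, Γ (h : PiTpχq p i j) = ((γ h : C.Huu) : PiTpχq p i j)) ∧
        (curveχq p i j).DeltaTemp.map Γ.toMulEquiv.toMonoidHom = (curveχq p i j).DeltaTemp) :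
    ∃ Φ : Gfp ≃ₜ* Gfp,
      (dUU l').map Φ.toMulEquiv.toMonoidHom = dUU l' ∧
      (∀ (d : Gfp) (hd : d ∈ dUU l'),
        (SemidirectProduct.inl (Φ d) : PiTpχq p i j) = ((γ ⟨SemidirectProduct.inl d, hinl d hd⟩ : C.Huu) : PiTpχq p i j)) ∧
      (∀ (σ : GQp p) (g : Gfp),
        (SemidirectProduct.inl (Φ (actχq p i j σ g)) : PiTpχq p i j) =
          ((γ ⟨SemidirectProduct.inr σ, hinr σ⟩ : C.Huu) : PiTpχq p i j) * SemidirectProduct.inl (Φ g) *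
            (((γ ⟨SemidirectProduct.inr σ, hinr σ⟩ : C.Huu) : PiTpχq p i j))⁻¹) := by
  obtain ⟨Γ, hΓ, hΔ⟩ := hγ
  -- `Γ` and `Γ⁻¹` map `inl Γ` into `inl Γ`
  have hΔ' : (curveχq p i j).DeltaTemp.map Γ.symm.toMulEquiv.toMonoidHom = (curveχq p i j).DeltaTemp := by
    have h := congrArg (Subgroup.map Γ.symm.toMulEquiv.toMonoidHom) hΔ
    rw [Subgroup.map_map] at h
    have hid : Γ.symm.toMulEquiv.toMonoidHom.comp Γ.toMulEquiv.toMonoidHom = MonoidHom.id _ :=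
      MonoidHom.ext fun x => Γ.symm_apply_apply x
    rw [hid, Subgroup.map_id] at h
    exact h.symm
  have hF := apply_inl_eq_inl_left_of_map_deltaTemp_eq Γ hΔ
  have hF' := apply_inl_eq_inl_left_of_map_deltaTemp_eq Γ.symm hΔ'
  -- the restriction `Φ`
  let f : Gfp → Gfp := fun g => (Γ (SemidirectProduct.inl g)).left
  let f' : Gfp → Gfp := fun g => (Γ.symm (SemidirectProduct.inl g)).left
  have hff' : ∀ g, f' (f g) = g := fun g => by
    have h : (SemidirectProduct.inl (f' (f g)) : PiTpχq p i j) = SemidirectProduct.inl g := by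
      change SemidirectProduct.inl (Γ.symm (SemidirectProduct.inl (Γ (SemidirectProduct.inl g)).left)).left =
        (SemidirectProduct.inl g : PiTpχq p i j)
      rw [← hF', ← hF, Γ.symm_apply_apply]
    exact SemidirectProduct.inl_injective h
  have hf'f : ∀ g, f (f' g) = g := fun g => by
    have h : (SemidirectProduct.inl (f (f' g)) : PiTpχq p i j) = SemidirectProduct.inl g := by
      change SemidirectProduct.inl (Γ (SemidirectProduct.inl (Γ.symm (SemidirectProduct.inl g)).left)).left =
        (SemidirectProduct.inl g : PiTpχq p i j)
      rw [← hF, ← hF', Γ.apply_symm_apply]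
    exact SemidirectProduct.inl_injective h
  have hcl : Continuous fun x : PiTpχq p i j => x.left := Semidirect.continuous_left (isInducing_leftRightχq p i j)
  let Φ : Gfp ≃ₜ* Gfp :=
    { toFun := f
      invFun := f'
      left_inv := hff'
      right_inv := hf'f
      map_mul' := fun a b => by
        have h : (SemidirectProduct.inl (f (a * b)) : PiTpχq p i j) = SemidirectProduct.inl (f a * f b) := by
          change SemidirectProduct.inl (Γ (SemidirectProduct.inl (a * b))).left =
            (SemidirectProduct.inl ((Γ (SemidirectProduct.inl a)).left * (Γ (SemidirectProduct.inl b)).left) :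
              PiTpχq p i j)
          rw [map_mul SemidirectProduct.inl (Γ (SemidirectProduct.inl a)).left, ← hF a, ← hF b, ← map_mul Γ,
            ← map_mul SemidirectProduct.inl, ← hF (a * b)]
        exact SemidirectProduct.inl_injective h
      continuous_toFun := hcl.comp (Γ.continuous.comp (continuous_inlχq p i j))
      continuous_invFun := hcl.comp (Γ.symm.continuous.comp (continuous_inlχq p i j)) }
  have hΦ : ∀ g, (SemidirectProduct.inl (Φ g) : PiTpχq p i j) = Γ (SemidirectProduct.inl g) := fun g => (hF g).symm
  refine ⟨Φ, ?_, fun d hd => ?_, fun σ g => ?_⟩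
  · -- (o) `Φ(dUU l) = dUU l`, from `Γ(Π^tp_{X̲̲}) = Π^tp_{X̲̲}` and `Γ(inl Γ) = inl Γ`
    ext d
    constructor
    · rintro ⟨d₀, hd₀, rfl⟩
      have hmem : Γ (SemidirectProduct.inl d₀) ∈ C.Huu := by
        rw [hΓ ⟨SemidirectProduct.inl d₀, hinl d₀ hd₀⟩]
        exact (γ _).2
      have := hleft _ hmem
      rwa [← hΦ, SemidirectProduct.left_inl] at this
    · intro hd
      refine ⟨Φ.symm d, ?_, Φ.apply_symm_apply d⟩
      have hmem : Γ.symm (SemidirectProduct.inl d) ∈ C.Huu := by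
        have h2 := (γ.symm ⟨SemidirectProduct.inl d, hinl d hd⟩).2
        have h3 : Γ ((γ.symm ⟨SemidirectProduct.inl d, hinl d hd⟩ : C.Huu) : PiTpχq p i j) = SemidirectProduct.inl d := by
          rw [hΓ, γ.apply_symm_apply]
        rw [← h3, Γ.symm_apply_apply]
        exact h2
      have := hleft _ hmem
      rwa [hF', SemidirectProduct.left_inl] at this
  · -- (i)
    rw [hΦ]
    exact hΓ ⟨_, hinl d hd⟩
  · -- (ii)
    rw [hΦ, SemidirectProduct.inl_aut]
    simp only [map_mul, map_inv]
    rw [← hΦ]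
    exact congrArg (fun t : PiTpχq p i j => t * SemidirectProduct.inl (Φ g) * t⁻¹) (hΓ ⟨_, hinr σ⟩)

/-! ## §2. (⇐) From `Φ` with (o)(i)(ii) to the extension `Γ x := inl (Φ x.left) · γ (inr x.right)` -/

include hinl hinr hleft in
/-- **(⇐) EXTENSION FROM THE GEOMETRIC DATUM.** If a bi-continuous automorphism `Φ` of `Γ = Gfp` satisfies (o) `Φ(dUU l) = dUU l`,
(i) `inl (Φ d) = γ (inl d)` on `dUU l` and (ii) `inl (Φ (σ·g)) = γ(inr σ) · inl (Φ g) · γ(inr σ)⁻¹`, then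
`Γ x := inl (Φ x.left) · γ (inr x.right)` is a `Δ^tp_X`-stabilising bi-continuous automorphism of `Π^tp_X` extending `γ`:
the clause `hextΔ(γ)` holds. [cite: MochizukiEtTh2009, Prop 2.4 p.38] -/
theorem hext_at_of_gfpAut (γ : ↥C.Huu ≃ₜ* ↥C.Huu) (Φ : Gfp ≃ₜ* Gfp)
    (hΦU : (dUU l').map Φ.toMulEquiv.toMonoidHom = dUU l')
    (hΦi : ∀ (d : Gfp) (hd : d ∈ dUU l'),
      (SemidirectProduct.inl (Φ d) : PiTpχq p i j) = ((γ ⟨SemidirectProduct.inl d, hinl d hd⟩ : C.Huu) : PiTpχq p i j))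
    (hΦii : ∀ (σ : GQp p) (g : Gfp),
      (SemidirectProduct.inl (Φ (actχq p i j σ g)) : PiTpχq p i j) =
        ((γ ⟨SemidirectProduct.inr σ, hinr σ⟩ : C.Huu) : PiTpχq p i j) * SemidirectProduct.inl (Φ g) *
          (((γ ⟨SemidirectProduct.inr σ, hinr σ⟩ : C.Huu) : PiTpχq p i j))⁻¹) :
    ∃ Γ : PiTpχq p i j ≃ₜ* PiTpχq p i j,
      (∀ h : C.Huu, Γ (h : PiTpχq p i j) = ((γ h : C.Huu) : PiTpχq p i j)) ∧
        (curveχq p i j).DeltaTemp.map Γ.toMulEquiv.toMonoidHom = (curveχq p i j).DeltaTemp := by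
  -- shorthand: the values of `γ`, `γ⁻¹` on the Galois section
  let e : GQp p → PiTpχq p i j := fun σ => ((γ ⟨SemidirectProduct.inr σ, hinr σ⟩ : C.Huu) : PiTpχq p i j)
  let e' : GQp p → PiTpχq p i j := fun σ => ((γ.symm ⟨SemidirectProduct.inr σ, hinr σ⟩ : C.Huu) : PiTpχq p i j)
  have he_mul : ∀ σ τ, e (σ * τ) = e σ * e τ := fun σ τ => by
    change ((γ ⟨SemidirectProduct.inr (σ * τ), hinr (σ * τ)⟩ : C.Huu) : PiTpχq p i j) = _
    have : (⟨SemidirectProduct.inr (σ * τ), hinr (σ * τ)⟩ : C.Huu) =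
        ⟨SemidirectProduct.inr σ, hinr σ⟩ * ⟨SemidirectProduct.inr τ, hinr τ⟩ := Subtype.ext (map_mul _ σ τ)
    rw [this, map_mul]
    rfl
  -- coercion bookkeeping on the subgroup `C.Huu`
  have hcoe_mul : ∀ a b : C.Huu, ((a * b : C.Huu) : PiTpχq p i j) = (a : PiTpχq p i j) * (b : PiTpχq p i j) := fun _ _ => rfl
  -- (i) for `(γ⁻¹, Φ⁻¹)`: `γ⁻¹ (inl d) = inl (Φ⁻¹ d)` on `dUU l`
  have hsymm_mem : ∀ d ∈ dUU l', Φ.symm d ∈ dUU l' := fun d hd => by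
    have h := (mem_iff_apply_mem_of_map_eq Φ.toMulEquiv (dUU l') hΦU (Φ.symm d))
    rw [show Φ.toMulEquiv (Φ.symm d) = d from Φ.apply_symm_apply d] at h
    exact h.2 hd
  have hΦi' : ∀ (d : Gfp) (hd : d ∈ dUU l'),
      ((γ.symm ⟨SemidirectProduct.inl d, hinl d hd⟩ : C.Huu) : PiTpχq p i j) = SemidirectProduct.inl (Φ.symm d) := by
    intro d hd
    have key : γ ⟨SemidirectProduct.inl (Φ.symm d), hinl _ (hsymm_mem d hd)⟩ = ⟨SemidirectProduct.inl d, hinl d hd⟩ := by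
      apply Subtype.ext
      rw [← hΦi (Φ.symm d) (hsymm_mem d hd), Φ.apply_symm_apply]
    rw [← key, γ.symm_apply_apply]
  -- every `h ∈ Π^tp_{X̲̲}` is `inl h.left · inr h.right` with `h.left ∈ dUU l`
  have hdec : ∀ h : C.Huu, (h : C.Huu) =
      ⟨SemidirectProduct.inl (h : PiTpχq p i j).left, hinl _ (hleft _ h.2)⟩ *
        ⟨SemidirectProduct.inr (h : PiTpχq p i j).right, hinr _⟩ := fun h =>
    Subtype.ext (SemidirectProduct.inl_left_mul_inr_right (h : PiTpχq p i j)).symm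
  -- the maps
  let F : PiTpχq p i j → PiTpχq p i j := fun x => SemidirectProduct.inl (Φ x.left) * e x.right
  let F' : PiTpχq p i j → PiTpχq p i j := fun y => SemidirectProduct.inl (Φ.symm y.left) * e' y.right
  -- `F` extends `γ`, `F'` extends `γ⁻¹`
  have hFγ : ∀ h : C.Huu, F (h : PiTpχq p i j) = ((γ h : C.Huu) : PiTpχq p i j) := fun h => by
    conv_rhs => rw [hdec h, map_mul, hcoe_mul]
    change SemidirectProduct.inl (Φ (h : PiTpχq p i j).left) * e (h : PiTpχq p i j).right = _
    rw [hΦi _ (hleft _ h.2)]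
  have hF'γ : ∀ h : C.Huu, F' (h : PiTpχq p i j) = ((γ.symm h : C.Huu) : PiTpχq p i j) := fun h => by
    conv_rhs => rw [hdec h, map_mul, hcoe_mul]
    change SemidirectProduct.inl (Φ.symm (h : PiTpχq p i j).left) * e' (h : PiTpχq p i j).right = _
    rw [hΦi' _ (hleft _ h.2)]
  -- coordinates of `F x`, `F' y`
  have hFl : ∀ x, (F x).left = Φ x.left * (e x.right).left := fun x => by
    change (SemidirectProduct.inl (Φ x.left) * e x.right).left = _
    rw [SemidirectProduct.mul_left, SemidirectProduct.left_inl, SemidirectProduct.right_inl, map_one, MulAut.one_apply]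
  have hFr : ∀ x, (F x).right = (e x.right).right := fun x => by
    change (SemidirectProduct.inl (Φ x.left) * e x.right).right = _
    rw [SemidirectProduct.mul_right, SemidirectProduct.right_inl, one_mul]
  have hF'l : ∀ y, (F' y).left = Φ.symm y.left * (e' y.right).left := fun y => by
    change (SemidirectProduct.inl (Φ.symm y.left) * e' y.right).left = _
    rw [SemidirectProduct.mul_left, SemidirectProduct.left_inl, SemidirectProduct.right_inl, map_one, MulAut.one_apply]
  have hF'r : ∀ y, (F' y).right = (e' y.right).right := fun y => by
    change (SemidirectProduct.inl (Φ.symm y.left) * e' y.right).right = _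
    rw [SemidirectProduct.mul_right, SemidirectProduct.right_inl, one_mul]
  -- `F' ∘ F = id`
  have hF'F : ∀ x, F' (F x) = x := fun x => by
    have hx : F' (F x) = SemidirectProduct.inl (Φ.symm (F x).left) * e' (F x).right := rfl
    rw [hx, hFl, hFr, map_mul, Φ.symm_apply_apply, map_mul, mul_assoc]
    -- `inl (Φ⁻¹ (e σ).left) · e' ((e σ).right) = γ⁻¹ (e σ) = inr σ`
    have key : SemidirectProduct.inl (Φ.symm (e x.right).left) * e' (e x.right).right =
        (SemidirectProduct.inr x.right : PiTpχq p i j) := by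
      have h1 := hF'γ (γ ⟨SemidirectProduct.inr x.right, hinr _⟩)
      rw [γ.symm_apply_apply] at h1
      exact h1
    rw [key, SemidirectProduct.inl_left_mul_inr_right]
  -- `F ∘ F' = id`
  have hFF' : ∀ y, F (F' y) = y := fun y => by
    have hy : F (F' y) = SemidirectProduct.inl (Φ (F' y).left) * e (F' y).right := rfl
    rw [hy, hF'l, hF'r, map_mul, Φ.apply_symm_apply, map_mul, mul_assoc]
    have key : SemidirectProduct.inl (Φ (e' y.right).left) * e (e' y.right).right =
        (SemidirectProduct.inr y.right : PiTpχq p i j) := by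
      have h1 := hFγ (γ.symm ⟨SemidirectProduct.inr y.right, hinr _⟩)
      rw [γ.apply_symm_apply] at h1
      exact h1
    rw [key, SemidirectProduct.inl_left_mul_inr_right]
  -- `F` is multiplicative, by the twisted equivariance (ii)
  have hΦii' : ∀ (σ : GQp p) (g : Gfp),
      (SemidirectProduct.inl (Φ (actχq p i j σ g)) : PiTpχq p i j) = e σ * SemidirectProduct.inl (Φ g) * (e σ)⁻¹ :=
    hΦii
  have hFmul : ∀ x y, F (x * y) = F x * F y := fun x y => by
    change SemidirectProduct.inl (Φ (x * y).left) * e (x * y).right =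
      SemidirectProduct.inl (Φ x.left) * e x.right * (SemidirectProduct.inl (Φ y.left) * e y.right)
    rw [SemidirectProduct.mul_left, SemidirectProduct.mul_right, map_mul, map_mul, he_mul, hΦii']
    group
  -- continuity
  have hcl : Continuous fun x : PiTpχq p i j => x.left := Semidirect.continuous_left (isInducing_leftRightχq p i j)
  have hcr : Continuous fun x : PiTpχq p i j => x.right := Semidirect.continuous_right (isInducing_leftRightχq p i j)
  have he : Continuous e :=
    continuous_subtype_val.comp (γ.continuous.comp ((continuous_inrχq p i j).subtype_mk _))
  have he' : Continuous e' :=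
    continuous_subtype_val.comp (γ.symm.continuous.comp ((continuous_inrχq p i j).subtype_mk _))
  have hFc : Continuous F :=
    ((continuous_inlχq p i j).comp (Φ.continuous.comp hcl)).mul (he.comp hcr)
  have hF'c : Continuous F' :=
    ((continuous_inlχq p i j).comp (Φ.symm.continuous.comp hcl)).mul (he'.comp hcr)
  let Γ : PiTpχq p i j ≃ₜ* PiTpχq p i j :=
    { toFun := F
      invFun := F'
      left_inv := hF'F
      right_inv := hFF'
      map_mul' := hFmul
      continuous_toFun := hFc
      continuous_invFun := hF'c }
  refine ⟨Γ, hFγ, ?_⟩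
  -- `Δ^tp_X`-stability: `(F x).right = 1 ↔ x.right = 1`
  have he1 : e 1 = 1 := by
    change ((γ ⟨SemidirectProduct.inr 1, hinr 1⟩ : C.Huu) : PiTpχq p i j) = 1
    have : (⟨SemidirectProduct.inr 1, hinr 1⟩ : C.Huu) = 1 := Subtype.ext (map_one _)
    rw [this, map_one]
    rfl
  have he'1 : e' 1 = 1 := by
    change ((γ.symm ⟨SemidirectProduct.inr 1, hinr 1⟩ : C.Huu) : PiTpχq p i j) = 1
    have : (⟨SemidirectProduct.inr 1, hinr 1⟩ : C.Huu) = 1 := Subtype.ext (map_one _)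
    rw [this, map_one]
    rfl
  ext x
  constructor
  · rintro ⟨y, hy, rfl⟩
    rw [SetLike.mem_coe, mem_deltaTempχq_iff] at hy
    change F y ∈ (curveχq p i j).DeltaTemp
    rw [mem_deltaTempχq_iff, hFr, hy, he1, SemidirectProduct.one_right]
  · intro hx
    refine ⟨F' x, ?_, hFF' x⟩
    rw [mem_deltaTempχq_iff] at hx
    rw [SetLike.mem_coe, mem_deltaTempχq_iff, hF'r, hx, he'1, SemidirectProduct.one_right]

/-! ## §3. The exact reduction -/

include hinl hinr hleft in
/-- **`hextΔ(γ)` ⟺ AN AUTOMORPHISM-EXTENSION PROBLEM ON THE GEOMETRIC GROUP `Γ = Gfp`.**  At an `X̲̲`-choice with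
`Π^tp_{X̲̲} = dUU l ⋊ G_{ℚ_p}` over the stage-2 Tate model, a bi-continuous automorphism `γ` of `Π^tp_{X̲̲}` extends to a
`Δ^tp_X`-stabilising bi-continuous automorphism of `Π^tp_X` IF AND ONLY IF its geometric part `γ|_{inl dUU l}` extends to a
bi-continuous automorphism `Φ` of `Γ` with `Φ(dUU l) = dUU l` which is equivariant for the Tate action up to the twist read off
`γ` on the Galois section: `inl (Φ (σ·g)) = γ(inr σ) · inl (Φ g) · γ(inr σ)⁻¹`.  (The booked reduction (1) of the verdict
«`hextΔ` UNDECIDED-AT-MODEL», in kernel; neither direction of `hextΔ` is claimed.) [cite: MochizukiEtTh2009, Prop 2.4 p.38] -/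
theorem hext_at_iff_exists_gfpAut (γ : ↥C.Huu ≃ₜ* ↥C.Huu) :
    (∃ Γ : PiTpχq p i j ≃ₜ* PiTpχq p i j,
      (∀ h : C.Huu, Γ (h : PiTpχq p i j) = ((γ h : C.Huu) : PiTpχq p i j)) ∧
        (curveχq p i j).DeltaTemp.map Γ.toMulEquiv.toMonoidHom = (curveχq p i j).DeltaTemp) ↔
    ∃ Φ : Gfp ≃ₜ* Gfp,
      (dUU l').map Φ.toMulEquiv.toMonoidHom = dUU l' ∧
      (∀ (d : Gfp) (hd : d ∈ dUU l'),
        (SemidirectProduct.inl (Φ d) : PiTpχq p i j) = ((γ ⟨SemidirectProduct.inl d, hinl d hd⟩ : C.Huu) : PiTpχq p i j)) ∧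
      (∀ (σ : GQp p) (g : Gfp),
        (SemidirectProduct.inl (Φ (actχq p i j σ g)) : PiTpχq p i j) =
          ((γ ⟨SemidirectProduct.inr σ, hinr σ⟩ : C.Huu) : PiTpχq p i j) * SemidirectProduct.inl (Φ g) *
            (((γ ⟨SemidirectProduct.inr σ, hinr σ⟩ : C.Huu) : PiTpχq p i j))⁻¹) :=
  ⟨exists_gfpAut_of_hext_at C hinl hinr hleft γ, fun ⟨Φ, hU, hi, hii⟩ => hext_at_of_gfpAut C hinl hinr hleft γ Φ hU hi hii⟩

/-- **The reduction AT THE CARRIER OF RECORD** `Π^tp_{X̲̲} = Huuχq p i j l hl` (the three membership clauses are theorems there):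
for every `X̲̲`-choice `C` over `modelχq p i j` with `C.Huu = Huuχq p i j l hl` (e.g. `doubleUnderlineχqOfEtaRes`, by `rfl`),
`hextΔ(γ) ⟺ ∃ Φ : Γ ≃ₜ* Γ, (o) ∧ (i) ∧ (ii)`. [cite: MochizukiEtTh2009, Prop 2.4 p.38] -/
theorem hext_at_iff_exists_gfpAut_of_eq (l' : ℕ+) (hl' : Odd (l' : ℕ)) (hCH : C.Huu = Huuχq p i j l' hl')
    (γ : ↥C.Huu ≃ₜ* ↥C.Huu) :
    (∃ Γ : PiTpχq p i j ≃ₜ* PiTpχq p i j,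
      (∀ h : C.Huu, Γ (h : PiTpχq p i j) = ((γ h : C.Huu) : PiTpχq p i j)) ∧
        (curveχq p i j).DeltaTemp.map Γ.toMulEquiv.toMonoidHom = (curveχq p i j).DeltaTemp) ↔
    ∃ Φ : Gfp ≃ₜ* Gfp,
      (dUU l').map Φ.toMulEquiv.toMonoidHom = dUU l' ∧
      (∀ (d : Gfp) (hd : d ∈ dUU l'),
        (SemidirectProduct.inl (Φ d) : PiTpχq p i j) =
          ((γ ⟨SemidirectProduct.inl d, hCH ▸ (inl_mem_Huuχq_iff p i j l' hl' d).2 hd⟩ : C.Huu) : PiTpχq p i j)) ∧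
      (∀ (σ : GQp p) (g : Gfp),
        (SemidirectProduct.inl (Φ (actχq p i j σ g)) : PiTpχq p i j) =
          ((γ ⟨SemidirectProduct.inr σ, hCH ▸ inr_mem_Huuχq p i j l' hl' σ⟩ : C.Huu) : PiTpχq p i j) *
            SemidirectProduct.inl (Φ g) *
            (((γ ⟨SemidirectProduct.inr σ, hCH ▸ inr_mem_Huuχq p i j l' hl' σ⟩ : C.Huu) : PiTpχq p i j))⁻¹) :=
  hext_at_iff_exists_gfpAut C (fun d hd => hCH ▸ (inl_mem_Huuχq_iff p i j l' hl' d).2 hd)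
    (fun σ => hCH ▸ inr_mem_Huuχq p i j l' hl' σ)
    (fun h hh => ((mem_Huuχq_iff p i j l' hl' h).1 (hCH ▸ hh)).1 |> fun hx =>
      (mem_dUU_iff l' h.left).2 ⟨hx, ((mem_Huuχq_iff p i j l' hl' h).1 (hCH ▸ hh)).2⟩) γ

/-! ## §4. (v2, append-only) Clause (o) is AUTOMATIC: `Φ(dUU l) ⊆ dUU l` and finite index force `Φ(dUU l) = dUU l` -/

/-- `dUU l ≤ Γ` has finite (non-zero) index: it contains `Ker(ĥ_l|_Γ)`, whose index is the order of a subgroup of the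
finite group `Heis(ℤ/l)`. [cite: MochizukiEtTh2009, Def 2.5 (i) p.39] -/
theorem index_dUU_ne_zero (l' : ℕ+) : (dUU l').index ≠ 0 := by
  have hle : (levelHom l').ker ≤ dUU l' := fun g hg => by
    rw [MonoidHom.mem_ker] at hg
    exact (mem_dUU_iff l' g).2 ⟨by rw [hg]; exact Heis.one_x, by rw [hg]; exact Heis.one_z⟩
  haveI : NeZero (l' : ℕ) := ⟨PNat.ne_zero l'⟩
  have hker : (levelHom l').ker.index ≠ 0 := by rw [Subgroup.index_ker]; exact Nat.card_pos.ne'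
  exact fun h0 => hker (zero_dvd_iff.mp (h0 ▸ Subgroup.index_dvd_of_le hle))

/-- **(o) ⟸ (into)**: a group automorphism `Φ` of `Γ` mapping `dUU l` INTO itself maps it ONTO itself (`Φ(dUU l) ≤ dUU l`
has the same finite index as `dUU l`). [cite: MochizukiEtTh2009, Def 2.5 (i) p.39] -/
theorem map_dUU_eq_of_forall_mem (l' : ℕ+) (Φ : Gfp ≃* Gfp) (h : ∀ d ∈ dUU l', Φ d ∈ dUU l') :
    (dUU l').map Φ.toMonoidHom = dUU l' := by
  have hle : (dUU l').map Φ.toMonoidHom ≤ dUU l' := by rintro _ ⟨d, hd, rfl⟩; exact h d hd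
  have h1 := Subgroup.relIndex_mul_index hle
  rw [Subgroup.index_map_of_bijective (f := Φ.toMonoidHom) Φ.bijective] at h1
  have hr : ((dUU l').map Φ.toMonoidHom).relIndex (dUU l') = 1 :=
    Nat.eq_of_mul_eq_mul_right (Nat.pos_of_ne_zero (index_dUU_ne_zero l')) (by rw [h1, one_mul])
  exact le_antisymm hle (Subgroup.relIndex_eq_one.mp hr)

include hinl hinr hleft in
/-- **THE EXACT REDUCTION, SHARPENED (clause (o) dropped).**  At an `X̲̲`-choice with `Π^tp_{X̲̲} = dUU l ⋊ G_{ℚ_p}`: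
`hextΔ(γ) ⟺ ∃ Φ : Γ ≃ₜ* Γ` with (i) `inl (Φ d) = γ (inl d)` on `dUU l` and (ii) `inl (Φ (σ·g)) = γ(inr σ) · inl (Φ g) ·
γ(inr σ)⁻¹` — (o) `Φ(dUU l) = dUU l` follows from (i) (`Φ(dUU l) ⊆ dUU l` by `hleft`, then finite index).  Neither direction of
`hextΔ` is claimed. [cite: MochizukiEtTh2009, Prop 2.4 p.38] -/
theorem hext_at_iff_exists_gfpAut' (γ : ↥C.Huu ≃ₜ* ↥C.Huu) :
    (∃ Γ : PiTpχq p i j ≃ₜ* PiTpχq p i j,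
      (∀ h : C.Huu, Γ (h : PiTpχq p i j) = ((γ h : C.Huu) : PiTpχq p i j)) ∧
        (curveχq p i j).DeltaTemp.map Γ.toMulEquiv.toMonoidHom = (curveχq p i j).DeltaTemp) ↔
    ∃ Φ : Gfp ≃ₜ* Gfp,
      (∀ (d : Gfp) (hd : d ∈ dUU l'),
        (SemidirectProduct.inl (Φ d) : PiTpχq p i j) = ((γ ⟨SemidirectProduct.inl d, hinl d hd⟩ : C.Huu) : PiTpχq p i j)) ∧
      (∀ (σ : GQp p) (g : Gfp),
        (SemidirectProduct.inl (Φ (actχq p i j σ g)) : PiTpχq p i j) =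
          ((γ ⟨SemidirectProduct.inr σ, hinr σ⟩ : C.Huu) : PiTpχq p i j) * SemidirectProduct.inl (Φ g) *
            (((γ ⟨SemidirectProduct.inr σ, hinr σ⟩ : C.Huu) : PiTpχq p i j))⁻¹) := by
  rw [hext_at_iff_exists_gfpAut C hinl hinr hleft γ]
  refine ⟨fun ⟨Φ, _, hi, hii⟩ => ⟨Φ, hi, hii⟩, fun ⟨Φ, hi, hii⟩ => ⟨Φ, ?_, hi, hii⟩⟩
  refine map_dUU_eq_of_forall_mem l' Φ.toMulEquiv fun d hd => ?_
  change Φ d ∈ dUU l'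
  have hmem : (SemidirectProduct.inl (Φ d) : PiTpχq p i j) ∈ C.Huu := by rw [hi d hd]; exact (γ _).2
  simpa only [SemidirectProduct.left_inl] using hleft _ hmem

end Literature.AnabelianGeometry.EtaleTheta.SettingModel

end
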